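import Mathlib
import Literature.NumberTheory.LFunctions.Zhang2022.Section12ShiftedContourZ22
import Literature.NumberTheory.LFunctions.Zhang2022.Section12ShiftedSmallCircleOmega
import Literature.NumberTheory.LFunctions.Zhang2022.Section12U024Mellin
import Literature.NumberTheory.LFunctions.Zhang2022.Section12U030SmoothingLemmas
import Literature.NumberTheory.LFunctions.Zhang2022.AppendixALemma83RelHolds
import Literature.NumberTheory.LFunctions.Zhang2022.SkeletonReductions
import HarnessLib

/-!
# Zhang (2022) §12 p. 70, proof of Lemma 12.3 (node u030): the `g`-smoothed `ξ_j`-sum EVALUATED —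
# Perron + the shifted Landau contour + the `ω₁`-circle, assembled (route (i) of record, `Λ = 𝓛³⁰`)

Topic `Literature/NumberTheory/LFunctions/Zhang2022` (Landau–Siegel audit tree; verdict-neutral).
Y. Zhang, *Discrete mean estimates and the Landau–Siegel zero*, arXiv:2211.02515v1 (2022)
[Zhang2022LandauSiegel] — **an unrefereed manuscript under adjudication** (lane ZHANG-L, WP12; rulings
S-8c / W12-R3: route (i) for the core `Typed.Sec12B.U030Rel` of the RT-02 leaf hTop25Ex). Everything here is
PROVED (theorems only; 0 new definitions, 0 named facts); nothing here is a claim about Theorems 1–2 of the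
source or about Landau–Siegel zeros.

DAG node served: `Z22:§12.u030` (proof of Lemma 12.3, p. 70, tex L3564): "In a way similar to the proof of
Lemma 12.1 [12.2] we deduce that [`Σ_{l<P″₂/dr} χ(l)ξ_j(l;d,r)l^{−(1−β₆+w)}`] `= L′(1,χ)Π(d,r)·(2πi)⁻¹∫_{|s|=5α}
(s+w−β₆+β_{j+1})(s+w−β₆+β_{j+2})/(s+w−β₆)·(P″₂/dr)^s ds/s + O(𝓛⁻¹⁵)`", in the RELATIVE currency of record
(error `O(𝓛⁻¹⁵·Π̂(dr)²)`, `Π̂ = ∏_{q∣dr}(1−q⁻¹)⁻¹`, row G-d55-3), for the `g`-SMOOTHED sum (`g = gW D`,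
`Λ = 𝓛³⁰`, (4.1)); the sharp-to-smooth step (`XiZeroMajorant.xi_sharp_sub_smooth_le`) and the closers
`u030Rel_of_lemma83Rel` / `u030Rel_holds` are the companion file `Section12U030RelHolds` (zl-w10-p4).

* `smoothed030_eval` — **for all large `D`, real primitive `χ` with (A), `1 ≤ j ≤ 3`, `d, r ≥ 1` with
  `P″₁ < dr < P₂`, `|w| = α`:
  `‖Σ_l χ(l)ξ₀ⱼ(l;d,r)l^{−(1−β₆+w)}g(P″₂/(drl)) − L′(1,χ)Π(d,r)·circ030‖ ≤ C·𝓛⁻¹⁵·Π̂(dr)²`.**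
  Chain (all tree theorems): Lemma 8.3 relative (`Skeleton.lemma83Rel_holds`) gives the continuation `𝔲`;
  Perron `GaussWeight.integral_LSeries_mul_kernel` (`s = 1−β₆+w`, `c = 1`, `X = P″₂/dr`; on `Re = 2 + Re w`
  the series is `𝔲·L·L/L` by Lemma 8.3 (ii) and `Typed.Sec12B.xiSeries_eq_LSeries`) = `perron_smoothed030_eq_vline`;
  the shifted big contour `Lemma84.ShiftedContour.norm_vline_sub_circ_le_Z22` (zl-libB-p5; `s₀ = β₆ − w`,
  `T ≤ P″₂/dr ≤ P` by `window_point_bounds`); the `ω₁`-circle package `Lemma84.circ_omega1_eval_forAllLarge`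
  (zl-w12-p8); and the identification of its closed form with `circ030` (`Typed.Sec12B.U031_holds` +
  `integral_cpow`).

## References

* Y. Zhang, arXiv:2211.02515v1 (2022), §12 proof of Lemma 12.3, p. 70 (tex L3564); proof of Lemma 12.2,
  p. 69 (u024–u025); §8 Lemma 8.4 (proof), p. 47; §4 (4.1). [cite: Zhang2022LandauSiegel, §12 Lemma 12.3 p.70]
* H. L. Montgomery, R. C. Vaughan, *Multiplicative Number Theory I*, CUP 2007, §5.1, §6.2.
  [cite: MontgomeryVaughan2007, §6.2]
-/

noncomputable section

open Complex Real MeasureTheory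

namespace Literature.NumberTheory.LFunctions.Zhang2022.Typed.Sec12B

open Literature.NumberTheory.LFunctions.Zhang2022.Skeleton
open Literature.NumberTheory.LFunctions.Zhang2022.GaussWeight
open LSeries (term)

variable (c' : ℝ) {D : ℕ} (χ : DirichletCharacter ℂ D)

/-! ### Small facts at the scales -/

section Facts

/-- `Re β₆ = 0`, `Im β₆ = 3α/2`. [cite: Zhang2022LandauSiegel, §8 (8.6)] -/
theorem beta6_re_im (D : ℕ) : (beta6 D).re = 0 ∧ (beta6 D).im = 3 * alpha D / 2 := by
  constructor
  · simp [beta6]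
  · simp [beta6]

/-- `‖β_j‖ ≤ 1/2` once `𝓛 ≥ 3` and `𝓛 ≥ 10|c′|π` (`β_j = jiα(1 ∓ c′α𝓛)`, `α = π𝓛⁻⁹`).
[cite: Zhang2022LandauSiegel, §2 (2.13)] -/
theorem norm_betaJ_le_half {D : ℕ} (h3 : 3 ≤ ell D) (hc : 10 * |c'| * π ≤ ell D) (j : ℕ) :
    ‖betaJ c' D j‖ ≤ 1 / 2 := by
  have hℓ0 : 0 < ell D := by linarith
  have hℓ1 : 1 ≤ ell D := by linarith
  have hαeq : alpha D = π / ell D ^ 9 := Lemma84.alpha_eq D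
  have hα0 : 0 < alpha D := by rw [hαeq]; positivity
  have hπ := Real.pi_gt_three
  have hπ4 := Real.pi_lt_four
  have h := Lemma84.norm_betaJ_le c' D j hα0.le hℓ0.le
  -- `α ≤ π/3⁹` and `5|c′|α𝓛 = 5|c′|π/𝓛⁸ ≤ 1/2`
  have h39 : (3 : ℝ) ^ 9 ≤ ell D ^ 9 := pow_le_pow_left₀ (by norm_num) h3 9
  have hα1 : alpha D ≤ 4 / 3 ^ 9 := by
    rw [hαeq, div_le_div_iff₀ (by positivity) (by positivity)]; nlinarith
  have hαℓ : alpha D * ell D = π / ell D ^ 8 := by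
    rw [hαeq]; field_simp
  have h8 : ell D ≤ ell D ^ 8 := le_self_pow₀ hℓ1 (by norm_num)
  have hcα : 5 * |c'| * alpha D * ell D ≤ 1 / 2 := by
    rw [mul_assoc (5 * |c'|), hαℓ]
    rw [show 5 * |c'| * (π / ell D ^ 8) = (5 * |c'| * π) / ell D ^ 8 by ring,
      div_le_iff₀ (by positivity)]
    nlinarith [abs_nonneg c']
  calc ‖betaJ c' D j‖ ≤ 3 * alpha D * (1 + 5 * |c'| * alpha D * ell D) := h
    _ ≤ 3 * (4 / 3 ^ 9) * (1 + 1 / 2) := by gcongr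
    _ ≤ 1 / 2 := by norm_num

/-- `log(dr) ≤ 𝓛⁹` and `dr < PT⁻²` on the u030 range `dr < P₂` (`P₂ ≤ P₁ ≤ PT⁻² ≤ P`, `𝓛 ≥ 2`).
[cite: Zhang2022LandauSiegel, §12 Lemma 12.3] -/
theorem range_facts_u030 {D : ℕ} (h2 : 2 ≤ Real.log D) {n : ℕ} (hn : 0 < n)
    (hP2 : (n : ℝ) < Skeleton.P2 D) :
    Real.log n ≤ Real.log D ^ 9 ∧ (n : ℝ) < bigP D / bigT D ^ 2 := by
  have hPT : Skeleton.P2 D ≤ bigP D / bigT D ^ 2 := (P2_le_P1 D).trans (P1_le_P_div_T_sq D h2)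
  have hT1 : 1 ≤ bigT D := by
    rw [bigT]; exact Real.one_le_exp (Real.rpow_nonneg (by rw [ell]; linarith) _)
  have hP0 : 0 < bigP D := Real.exp_pos _
  have hnP : (n : ℝ) < bigP D :=
    lt_of_lt_of_le (lt_of_lt_of_le hP2 hPT) (div_le_self hP0.le (one_le_pow₀ hT1))
  refine ⟨?_, lt_of_lt_of_le hP2 hPT⟩
  calc Real.log n ≤ Real.log (bigP D) := Real.log_le_log (by exact_mod_cast hn) hnP.le
    _ = Real.log D ^ 9 := by rw [bigP, Real.log_exp, ell]

end Facts

/-! ### The Perron identity for the smoothed sum -/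

section Perron

/-- The `g`-smoothed `ξ_j`-sum is the `L`-series Perron integral on `Re = 1` of the Gaussian kernel
`Y^{s}ω₁(s)/s` (`Λ = 𝓛³⁰`, `Y = P″₂/dr`): `Σ_l χ(l)ξ₀ⱼ(l;d,r)l^{−(1−β₆+w)}g(Y/l) =
(1/2π)∫_ℝ L(χξ₀ⱼ, 1−β₆+w+1+it)·Y^{1+it}ω₁(1+it)/(1+it) dt` — the tree's `GaussWeight.integral_LSeries_mul_kernel`
at `a = χξ₀ⱼ(·;d,r)`, `s = 1−β₆+w`, `c = 1` (absolute convergence at `Re = 2 + Re w > 1`,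
`Lemma83.lseriesSummable_chi_mul_xiZero`). [cite: Zhang2022LandauSiegel, §12 p.70 (u030), §4 (4.1)]
[cite: MontgomeryVaughan2007, §5.1] -/
theorem perron_smoothed030_eq_vline (hD : 3 ≤ D) {d r : ℕ} (hd : d ≠ 0) (hr : r ≠ 0) (j : ℕ)
    {w : ℂ} (hw : -1 < w.re) {Y : ℝ} (hY : 0 < Y) :
    (∑' l : ℕ, χ (l : ZMod D) * xiZero c' D j l d r / (l : ℂ) ^ (1 - beta6 D + w) *
        (gW D (Y / l) : ℂ)) =
      (1 / (2 * π) : ℂ) * ∫ t : ℝ,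
        LSeries (fun n => χ (n : ZMod D) * xiZero c' D j n d r) (1 - beta6 D + w + (((1 : ℝ) : ℂ) + t * I)) *
          ((Y : ℂ) ^ ((((1 : ℝ) : ℂ) + t * I) + 0) * omega1 (ell D ^ 30) ((((1 : ℝ) : ℂ) + t * I) + 0) /
            ((((1 : ℝ) : ℂ) + t * I) + 0)) := by
  set a : ℕ → ℂ := fun n => χ (n : ZMod D) * xiZero c' D j n d r with ha
  set s : ℂ := 1 - beta6 D + w with hs_def
  have hΛ : 0 < ell D ^ 30 := ell_pow_thirty_pos hD
  have hsum : LSeriesSummable a (s + ((1 : ℝ) : ℂ)) := by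
    refine Lemma83.lseriesSummable_chi_mul_xiZero c' D j χ hd hr ?_
    have hβ : (beta6 D).re = 0 := (beta6_re_im D).1
    simp only [hs_def, add_re, sub_re, one_re, hβ, ofReal_re]
    linarith
  have hmain := integral_LSeries_mul_kernel (a := a) (s := s) hΛ one_pos hY hsum
  -- left side
  have hL : (∑' l : ℕ, χ (l : ZMod D) * xiZero c' D j l d r / (l : ℂ) ^ (1 - beta6 D + w) *
        (gW D (Y / l) : ℂ)) = ∑' n : ℕ, term a s n * (gWeight (ell D ^ 30) (Y / n) : ℂ) := by
    refine tsum_congr (fun l => ?_)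
    rcases eq_or_ne l 0 with rfl | hl
    · simp [LSeries.term_zero, Lemma83.xiZero_apply_zero]
    · rw [LSeries.term_of_ne_zero hl, gW]
  rw [hL, ← hmain]
  congr 1
  refine integral_congr_ae (ae_of_all _ (fun t => ?_))
  simp only [kernel, add_zero, hs_def]

end Perron

/-! ### The evaluation -/

section Eval

/-- `∫₁^Y y^{β₆−w−1} dy = (Y^{β₆−w} − 1)/(β₆ − w)` (`Y ≥ 1`, `β₆ ≠ w`). [folklore] -/
private theorem integral_rpow_beta6_sub (D : ℕ) {w : ℂ} (hne : beta6 D - w ≠ 0) {Y : ℝ} (hY : 1 ≤ Y) :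
    (∫ y in (1 : ℝ)..Y, (y : ℂ) ^ (beta6 D - w - 1)) =
      (((Y : ℝ) : ℂ) ^ (beta6 D - w) - 1) / (beta6 D - w) := by
  have h := integral_cpow (a := (1 : ℝ)) (b := Y) (r := beta6 D - w - 1) (Or.inr ⟨?_, ?_⟩)
  · rw [h]
    simp only [sub_add_cancel, ofReal_one, one_cpow]
  · intro h0
    apply hne
    have := congrArg (· + 1) h0
    simpa using this
  · rw [Set.uIcc_of_le hY]
    intro h0
    exact absurd h0.1 (by norm_num)

set_option maxHeartbeats 1600000 in
/-- **u030, the smoothed sum evaluated (route (i) of record, `Λ = 𝓛³⁰`).** There is an absolute `C` such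
that for all large `D`, every real primitive `χ (mod D)` with (A), `1 ≤ j ≤ 3`, `d, r ≥ 1` with
`P″₁ < dr < P₂` and `|w| = α`:
`‖Σ_l χ(l)ξ₀ⱼ(l;d,r)l^{−(1−β₆+w)}g(P″₂/(drl)) − L′(1,χ)Π(d,r)·circ030(w)‖ ≤ C·𝓛⁻¹⁵·(∏_{q∣dr}(1−q⁻¹)⁻¹)²`.
(Perron `perron_smoothed030_eq_vline` → `Lemma84.ShiftedContour.norm_vline_sub_circ_le_Z22` →
`Lemma84.circ_omega1_eval_forAllLarge` → `U031_holds`; the continuation `𝔲` from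
`Skeleton.lemma83Rel_holds`.) [cite: Zhang2022LandauSiegel, §12 proof of Lemma 12.3, p. 70, tex L3564]
[cite: MontgomeryVaughan2007, §6.2] -/
theorem smoothed030_eval (c' : ℝ) : ∃ C : ℝ, ForAllLarge fun D _ χ => AssumptionA D χ →
    ∀ j ∈ ({1, 2, 3} : Finset ℕ), ∀ d r : ℕ, 1 ≤ d → 1 ≤ r →
      P1pp D < ((d * r : ℕ) : ℝ) → ((d * r : ℕ) : ℝ) < Skeleton.P2 D → ∀ w : ℂ, ‖w‖ = alpha D →
        ‖(∑' l : ℕ, χ (l : ZMod D) * xiZero c' D j l d r / (l : ℂ) ^ (1 - beta6 D + w) *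
              (gW D (P2pp D / ((d * r : ℕ) : ℝ) / l) : ℂ)) -
            deriv χ.LFunction 1 * PiW χ d r * circ030 c' D j d r w‖ ≤
          C * (ell D ^ 15)⁻¹ * (∏ q ∈ (d * r).primeFactors, (1 - (q : ℝ)⁻¹)⁻¹) ^ 2 := by
  -- the four packaged inputs
  obtain ⟨C83, D₁, h83⟩ := lemma83Rel_holds c'
  obtain ⟨C₀, hC₀0, D₂, hZ22⟩ :=
    Lemma84.ShiftedContour.norm_vline_sub_circ_le_Z22 (C₈₃ := |C83|) (abs_nonneg _) 15
  obtain ⟨Cω, hCω0, D₃, hω⟩ := Lemma84.circ_omega1_eval_forAllLarge c' C83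
  obtain ⟨D₄, h31⟩ := U031_holds c'
  -- the numerical threshold: `𝓛 ≥ 4` and `𝓛 ≥ 10|c′|π`
  set Lmax : ℝ := max 4 (10 * |c'| * π) with hLmax
  set D₅ : ℕ := ⌈Real.exp Lmax⌉₊ with hD₅
  refine ⟨C₀ + Cω, max (max (max D₁ D₂) (max D₃ D₄)) D₅, ?_⟩
  intro D _ χ hD hq hp hA j hj d r hd hr h1 h2 w hw
  have hD₁ : D₁ ≤ D :=
    le_trans (le_trans (le_max_left _ _) (le_max_left _ _)) (le_trans (le_max_left _ _) hD)
  have hD₂ : D₂ ≤ D :=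
    le_trans (le_trans (le_max_right _ _) (le_max_left _ _)) (le_trans (le_max_left _ _) hD)
  have hD₃ : D₃ ≤ D :=
    le_trans (le_trans (le_max_left _ _) (le_max_right _ _)) (le_trans (le_max_left _ _) hD)
  have hD₄ : D₄ ≤ D :=
    le_trans (le_trans (le_max_right _ _) (le_max_right _ _)) (le_trans (le_max_left _ _) hD)
  have hD₅' : D₅ ≤ D := le_trans (le_max_right _ _) hD
  -- `𝓛 ≥ Lmax`, `D ≥ 9`
  have hDexpL : Real.exp Lmax ≤ D := le_trans (Nat.le_ceil _) (by exact_mod_cast hD₅')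
  have hD0 : (0 : ℝ) < D := lt_of_lt_of_le (Real.exp_pos _) hDexpL
  have hLm : Lmax ≤ ell D := by
    rw [ell, Real.le_log_iff_exp_le hD0]; exact hDexpL
  have hℓ4 : 4 ≤ ell D := le_trans (le_max_left _ _) hLm
  have hℓc : 10 * |c'| * π ≤ ell D := le_trans (le_max_right _ _) hLm
  have hℓ3 : 3 ≤ ell D := by linarith
  have hℓ1 : 1 ≤ ell D := by linarith
  have hlog2 : 2 ≤ Real.log D := by rw [← ell]; linarith
  have hD9 : 9 ≤ D := by
    have h4 : Real.exp 4 ≤ Real.exp Lmax := Real.exp_le_exp.mpr (le_max_left _ _)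
    have h9 : (9 : ℝ) ≤ Real.exp 4 := by
      have h2 : (3 : ℝ) ≤ Real.exp 2 := by have := Real.add_one_le_exp (2 : ℝ); linarith
      have : Real.exp 4 = Real.exp 2 * Real.exp 2 := by rw [← Real.exp_add]; norm_num
      rw [this]; nlinarith
    exact_mod_cast (h9.trans (h4.trans hDexpL))
  have hD3 : 3 ≤ D := le_trans (by norm_num) hD9
  have hD2 : 2 ≤ D := le_trans (by norm_num) hD9
  have hχ1 : χ ≠ 1 := Lemma31.ne_one_of_isPrimitive χ hD2 hp
  have hAlt : ‖χ.LFunction 1‖ < (Real.log D ^ 2022)⁻¹ := by rw [← one_div]; exact hA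
  -- `α`
  have hαeq : alpha D = π / ell D ^ 9 := Lemma84.alpha_eq D
  have hα0 : 0 < alpha D := by rw [hαeq]; positivity
  have hα1 : alpha D < 1 := alpha_lt_one hD9
  have hwre : -1 < w.re := neg_one_lt_re_of_norm_eq_alpha hα1 hw
  -- `d`, `r`, the range
  have hd0 : d ≠ 0 := by omega
  have hr0 : r ≠ 0 := by omega
  have hdr0 : d * r ≠ 0 := mul_ne_zero hd0 hr0
  have hdrpos : 0 < d * r := Nat.pos_of_ne_zero hdr0
  obtain ⟨hlogdr, hdrPT⟩ := range_facts_u030 hlog2 hdrpos h2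
  -- `Y = P″₂/dr ∈ [T, P]`
  set Y : ℝ := P2pp D / ((d * r : ℕ) : ℝ) with hYdef
  obtain ⟨hTY10, hYP⟩ := window_point_bounds hℓ1 h1 h2
  have hT1 : 1 ≤ bigT D := by
    rw [bigT]; exact Real.one_le_exp (Real.rpow_nonneg (by linarith) _)
  have hTY : bigT D ≤ Y := le_trans (le_self_pow₀ hT1 (by norm_num)) hTY10
  have hY1 : 1 ≤ Y := hT1.trans hTY
  have hY0 : 0 < Y := by linarith
  have hΛ1 : 1 ≤ ell D ^ 30 := one_le_pow₀ hℓ1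
  -- the continuation `𝔲` of Lemma 8.3 (relative form)
  obtain ⟨U, hUd, hU1, hU2, hU3⟩ := h83 D χ hD₁ hq hp hA j hj d r hd hr hdrPT
  have hU2' : ∀ s : ℂ, 9 / 10 < s.re →
      ‖U s‖ ≤ |C83| * ∏ q ∈ (d * r).primeFactors, (1 + |C83| * (q : ℝ) ^ (-s.re)) := by
    intro s hs
    calc ‖U s‖ ≤ C83 * ∏ q ∈ (d * r).primeFactors, (1 + C83 * (q : ℝ) ^ (-s.re)) := hU2 s hs
      _ ≤ |C83 * ∏ q ∈ (d * r).primeFactors, (1 + C83 * (q : ℝ) ^ (-s.re))| := le_abs_self _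
      _ = |C83| * ∏ q ∈ (d * r).primeFactors, |1 + C83 * (q : ℝ) ^ (-s.re)| := by
          rw [abs_mul, Finset.abs_prod]
      _ ≤ |C83| * ∏ q ∈ (d * r).primeFactors, (1 + |C83| * (q : ℝ) ^ (-s.re)) := by
          refine mul_le_mul_of_nonneg_left ?_ (abs_nonneg C83)
          refine Finset.prod_le_prod (fun _ _ => abs_nonneg _) fun q _ => ?_
          calc |1 + C83 * (q : ℝ) ^ (-s.re)| ≤ |(1 : ℝ)| + |C83 * (q : ℝ) ^ (-s.re)| := abs_add_le _ _
            _ = 1 + |C83| * (q : ℝ) ^ (-s.re) := by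
                rw [abs_one, abs_mul, abs_of_nonneg (Real.rpow_nonneg (Nat.cast_nonneg q) _)]
  -- the shifts
  set βa : ℂ := betaJ c' D (j + 1) with hβa
  set βb : ℂ := betaJ c' D (j + 2) with hβb
  have hβare : βa.re = 0 := Lemma84.betaJ_re c' D (j + 1)
  have hβbre : βb.re = 0 := Lemma84.betaJ_re c' D (j + 2)
  have hβa1 : ‖βa‖ ≤ 1 / 2 := norm_betaJ_le_half c' hℓ3 hℓc (j + 1)
  have hβb1 : ‖βb‖ ≤ 1 / 2 := norm_betaJ_le_half c' hℓ3 hℓc (j + 2)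
  obtain ⟨hs0ne, hs0n, -⟩ := Lemma84.center_shift_bounds hα0 hw
  have hβ6 := beta6_re_im D
  have hs0im : (beta6 D - w).im ≠ 0 := by
    have hwim : |w.im| ≤ ‖w‖ := Complex.abs_im_le_norm w
    rw [hw] at hwim
    have := (abs_le.mp hwim).2
    rw [Complex.sub_im, hβ6.2]
    intro h0
    linarith
  -- `Φ`
  set Φ : ℂ → ℂ := fun z => U (1 - beta6 D + w + z) * χ.LFunction (1 - beta6 D + w + z + βa) *
      χ.LFunction (1 - beta6 D + w + z + βb) / χ.LFunction (1 - beta6 D + w + z) with hΦdef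
  have hΦ : ∀ s : ℂ, Φ s = U (1 - (beta6 D - w) + s) * χ.LFunction (1 - (beta6 D - w) + s + βa) *
      χ.LFunction (1 - (beta6 D - w) + s + βb) / χ.LFunction (1 - (beta6 D - w) + s) := by
    intro s
    rw [show (1 : ℂ) - (beta6 D - w) + s = 1 - beta6 D + w + s by ring]
  -- STEP A. Perron: the smoothed sum is the line integral of `Φ` on `Re = 1`
  have hPer := perron_smoothed030_eq_vline c' χ hD3 hd0 hr0 j hwre hY0
  have hLΦ : ∀ t : ℝ, LSeries (fun n => χ (n : ZMod D) * xiZero c' D j n d r)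
      (1 - beta6 D + w + (((1 : ℝ) : ℂ) + t * I)) = Φ (((1 : ℝ) : ℂ) + t * I) := by
    intro t
    set u : ℂ := 1 - beta6 D + w + (((1 : ℝ) : ℂ) + t * I) with hu
    have hure : u.re = 2 + w.re := by
      simp [hu, hβ6.1]; ring
    have hu1 : 1 < u.re := by rw [hure]; linarith
    have hua : 1 < (u + βa).re := by rw [Complex.add_re, hβare]; linarith
    have hub : 1 < (u + βb).re := by rw [Complex.add_re, hβbre]; linarith
    have hL0 : χ.LFunction u ≠ 0 :=
      DirichletCharacter.LFunction_ne_zero_of_one_le_re χ (Or.inl hχ1) hu1.le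
    have hLa : χ.LFunction (u + βa) ≠ 0 :=
      DirichletCharacter.LFunction_ne_zero_of_one_le_re χ (Or.inl hχ1) hua.le
    have hLb : χ.LFunction (u + βb) ≠ 0 :=
      DirichletCharacter.LFunction_ne_zero_of_one_le_re χ (Or.inl hχ1) hub.le
    have hX := hU1 u hu1
    rw [← xiSeries_eq_LSeries]
    show xiSeries c' χ j d r u = U u * χ.LFunction (u + βa) * χ.LFunction (u + βb) / χ.LFunction u
    rw [hX]
    field_simp
  have hvline : (∑' l : ℕ, χ (l : ZMod D) * xiZero c' D j l d r / (l : ℂ) ^ (1 - beta6 D + w) *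
        (gW D (Y / l) : ℂ)) =
      (1 / (2 * π) : ℂ) * ∫ t : ℝ, Φ (((1 : ℝ) : ℂ) + t * I) *
        ((Y : ℂ) ^ ((((1 : ℝ) : ℂ) + t * I) + 0) * omega1 (ell D ^ 30) ((((1 : ℝ) : ℂ) + t * I) + 0) /
          ((((1 : ℝ) : ℂ) + t * I) + 0)) := by
    rw [hPer]
    congr 1
    refine integral_congr_ae (ae_of_all _ (fun t => ?_))
    simp only [hLΦ t]
  -- STEP B. The shifted big contour (zl-libB-p5's instance at Zhang's objects)
  have hbig := hZ22 hD₂ χ hχ1 hAlt U Φ (beta6 D - w) βa βb (n := d * r) (Y := Y) hdr0 hlogdr hUd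
    hU2' hβare hβa1 hβbre hβb1 hs0n hs0im hΦ hTY hYP
  -- STEP C. The `ω₁`-circle, evaluated (zl-w12-p8's package)
  have hcirc := hω D χ hD₃ hq hp hA j d r hd0 hr0 U hUd hU3 w hw Y hY1 hYP (ell D ^ 30) hΛ1
  -- the two circle integrals are the same term
  have hΦz : ∀ z : ℂ, Φ z * ((Y : ℂ) ^ (z + 0) * omega1 (ell D ^ 30) (z + 0) / (z + 0)) =
      U (1 - beta6 D + w + z) * χ.LFunction (1 - beta6 D + w + z + betaJ c' D (j + 1)) *
          χ.LFunction (1 - beta6 D + w + z + betaJ c' D (j + 2)) /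
          χ.LFunction (1 - beta6 D + w + z) *
        (((Y : ℝ) : ℂ) ^ (z + 0) * omega1 (ell D ^ 30) (z + 0) / (z + 0)) := fun z => rfl
  simp_rw [hΦz] at hbig
  -- STEP D. The closed form is `L′(1,χ)Π·circ030`
  have h31' := h31 D χ hD₄ hq hp j hj d r hd hr h1 h2 w hw
  have hint := integral_rpow_beta6_sub D hs0ne hY1
  have hmain : deriv χ.LFunction 1 * PiW χ d r * circ030 c' D j d r w =
      PiW χ d r * deriv χ.LFunction 1 *
        (w - beta6 D + betaJ c' D (j + 1) + betaJ c' D (j + 2) +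
          betaJ c' D (j + 1) * betaJ c' D (j + 2) *
            ((((Y : ℝ) : ℂ) ^ (beta6 D - w) - 1) / (beta6 D - w))) := by
    rw [h31', ← hYdef, hint]; ring
  -- STEP E. Triangle inequality and constants
  have hPi : 1 ≤ (∏ q ∈ (d * r).primeFactors, (1 - (q : ℝ)⁻¹)⁻¹) ^ 2 :=
    one_le_pow₀ (Literature.NumberTheory.Sieve.GreenTao2008.GYCorr.one_le_prod_one_sub_inv_inv (d * r))
  rw [hvline, hmain]
  set V := (1 / (2 * π) : ℂ) * ∫ t : ℝ, Φ (((1 : ℝ) : ℂ) + t * I) *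
      ((Y : ℂ) ^ ((((1 : ℝ) : ℂ) + t * I) + 0) * omega1 (ell D ^ 30) ((((1 : ℝ) : ℂ) + t * I) + 0) /
        ((((1 : ℝ) : ℂ) + t * I) + 0)) with hV
  set Cz := (2 * π * I)⁻¹ * (∮ z in C(beta6 D - w, 3 * alpha D),
      U (1 - beta6 D + w + z) * χ.LFunction (1 - beta6 D + w + z + betaJ c' D (j + 1)) *
          χ.LFunction (1 - beta6 D + w + z + betaJ c' D (j + 2)) /
          χ.LFunction (1 - beta6 D + w + z) *
        (((Y : ℝ) : ℂ) ^ (z + 0) * omega1 (ell D ^ 30) (z + 0) / (z + 0))) with hCz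
  set M := PiW χ d r * deriv χ.LFunction 1 *
      (w - beta6 D + betaJ c' D (j + 1) + betaJ c' D (j + 2) +
        betaJ c' D (j + 1) * betaJ c' D (j + 2) *
          ((((Y : ℝ) : ℂ) ^ (beta6 D - w) - 1) / (beta6 D - w))) with hM
  have e : V - M = (V - Cz) + (Cz - M) := by ring
  calc ‖V - M‖ = ‖(V - Cz) + (Cz - M)‖ := by rw [e]
    _ ≤ ‖V - Cz‖ + ‖Cz - M‖ := norm_add_le _ _
    _ ≤ C₀ * (ell D ^ 15)⁻¹ +
        Cω * (ell D ^ 15)⁻¹ * (∏ q ∈ (d * r).primeFactors, (1 - (q : ℝ)⁻¹)⁻¹) ^ 2 := add_le_add hbig hcirc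
    _ ≤ C₀ * (ell D ^ 15)⁻¹ * (∏ q ∈ (d * r).primeFactors, (1 - (q : ℝ)⁻¹)⁻¹) ^ 2 +
        Cω * (ell D ^ 15)⁻¹ * (∏ q ∈ (d * r).primeFactors, (1 - (q : ℝ)⁻¹)⁻¹) ^ 2 :=
        add_le_add (le_mul_of_one_le_right (by positivity) hPi) le_rfl
    _ = (C₀ + Cω) * (ell D ^ 15)⁻¹ * (∏ q ∈ (d * r).primeFactors, (1 - (q : ℝ)⁻¹)⁻¹) ^ 2 := by ring

end Eval

end Literature.NumberTheory.LFunctions.Zhang2022.Typed.Sec12B
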